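import Summits.QuantumFields.BalabanUV.T4Continuum.Support.NE3SlicePoincareBudget
import Summits.QuantumFields.BalabanUV.T4Continuum.Support.NE3SlicePoincareEtaBound
import Summits.QuantumFields.BalabanUV.T4Continuum.Support.NE3SlicePoincareGradientBudget
import Summits.QuantumFields.BalabanUV.T4Continuum.Support.NE3SlicePoincareCompetitorEnd
import Summits.QuantumFields.BalabanUV.T4Continuum.Support.NE3SlicePoincareYBound
import Summits.QuantumFields.BalabanUV.T4Continuum.Support.NE3SpectralCutTorus
import Summits.QuantumFields.BalabanUV.T4Continuum.Support.NE3TopRadiusLetters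
import HarnessLib

/-!
# NE3SlicePoincareCurved (T⁴ programme, node NE3, row K6 of ruling ρ-g22-2, part K6c-2b of the cut ρ-g23-3 — THE END OF ROUTE H♮'s K6):
# (P♮)_W — THE SLICE POINCARÉ INEQUALITY ON `T_♮(W) = frameFreeBlockLandauW L N (k+1) W` AT A CURVED BACKGROUND OF THE TOWER CLASS

Leaf seat `b2b-balaban-t4-ne3-formalise-leaf-02` (gen 6), row K6 (booked → leaf-02 lineage; blueprint `HOME/t4/b2b-balaban-t4-ne3-p1/g23/D-ne3p1-g23-1.md`;
derivation `HOME/t4/b2b-balaban-t4-ne3-formalise-leaf-02/g6/K6c-BUDGET.md`).  ASSEMBLY BY NAME: K1-inst `NE3SpectralCutTorus.exists_covHodge_cut` (cut `ϑ := ε²∕M²`),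
K6c-1a `NE3SlicePoincareEtaBound.eta_sq_le`, K6b-S5 `NE3SlicePoincareGradientBudget.covFd_energy_le`, K6c-1b `NE3SlicePoincareCompetitorEnd.exists_competitor`,
`NE3SlicePoincareYBound.y_sq_le` ∕ `xi_sq_le`, NE3-R2's Jensen `NE3NestedBlockMeanJensenHS.sum_nhsNormSq_bmeanIterW_le_one` and `NE3TopRadiusLetters.E_le_half_of_levelSmall`,
K6c-2a `NE3SlicePoincareBudget.budget`, K6a `NE3SlicePoincareSkeleton.slicePoincare_of_nhs`.
WHAT ([folklore]; 0 sorry; 0 def): **`slicePoincare_frameFreeBlockLandauW`** — for `3 ≤ d`, `2 ≤ L`, `1 ≤ N`, every `k`, a unitary `W` of period `tower L N (k+1)` in the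
tower's small-field class (`0 ≤ x`, `LevelSmall d L k x`, `SmallField W x`, `S2sum d L (k+1) x ≤ ρ∕2`, K6-Ξ's displayed smallness), every `ε > 0` and the TWO DISPLAYED
SMALLNESS CONDITIONS of the budget (`S_h ≤ 1∕2`, `2K_h·S_y + s₂ ≤ 1∕2`, written out in `M = L^{k+1}`, `ε`, `x`, `loopRad(r_k)`, `DSum`, `S2sum`, `radIter`, `d`, `L`, `card n`):
`SlicePoincare L (k+1) W (frameFreeBlockLandauW L N (k+1) W) (card n · 16·A·K_h) (periodBox (N·L^{k+1}))`, `A = 18 + 1∕4 + 16·c_f·√(card n)∕ε²`.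
HONEST FRAMING.  (P♮)_W at ONE background of the class under displayed smallness; the constants are honest box counting (census D-ne3r2-g9-5: k-FREE, θ ≲ 1e-36,
C ≈ 1e16 at d = 4); nothing about Bałaban's minimisers; (ML_w) follows only through the owner's junction `NE3EnergyRateWSupOfSlicePoincare`; T-E_w and **NE3 are NOT proved**;
spine PROVED 0∕9; finite T⁴ rung (B)+1 — NOT infinite volume, NOT mass gap, NOT BetaPertH, NOT Clay.  ABSOLUTE RULE kept: no printed sentence is a hypothesis.
PLACEMENT: `Summits/QuantumFields/BalabanUV/`.  HONEST DEPENDENCY: continuum YM on T⁴ ⇐ BetaPertH ∧ nine spine estimates (0/9 proved); BetaPertH ⇐ (D1) ∧ (D4) ∧ CAP+tail;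
G-an2-4 gates asym, D1 and NE2/3/4.
-/

set_option autoImplicit false

open scoped BigOperators Matrix.Norms.L2Operator
open Finset

namespace Summit.QuantumFields.BalabanUV.T4Continuum.NE3SlicePoincareCurved

open Literature.MathematicalPhysics.QuantumFieldTheory.Balaban1983to89
open B7Prop1Explicit B7Prop2Explicit MatrixNorms
open T4AveragingDeficitWall (IsUnitaryCfg IsSkewDir SmallField)
open T4AveragingDeficitWallBoundary (IsPeriodicCfg periodBox)
open AveragingDeficitPeriodicCounting (IsPeriodicDir)
open AveragingDeficitTwoLevelPrep (prop1Radius)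
open AveragingDeficitMultiLevelPrep (cavgIter tower LevelSmall radIter)
open SpreadLift (loopRad)
open BlockAveragePushDirGauge (gaugeDir)
open NE3CovariantCalculus (hsR)
open NE3CovariantWeitzenbock (covDiv)
open NE3CovariantBlockMean (bmeanIterW)
open NE3CovariantLineSumsL2Tower (rho S2sum)
open NE3ExactLineSumsTower (DSum)
open NE3FrameFreeSliceW (frameFreeBlockLandauW)
open NE3SlicePoincareShape (SlicePoincare)
open NE3SlicePoincareSkeleton (slicePoincare_of_nhs)
open NE3SpectralCutTorus (exists_covHodge_cut)
open NE3SlicePoincareEtaBound (eta_sq_le)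
open NE3SlicePoincareGradientBudget (covFd_energy_le)
open NE3SlicePoincareCompetitorEnd (exists_competitor)
open NE3SlicePoincareYBound (y_sq_le xi_sq_le)
open NE3NestedBlockMeanJensenHS (sum_nhsNormSq_bmeanIterW_le_one)
open NE3TopRadiusLetters (E_le_half_of_levelSmall)
open NE3SlicePoincareBudget (budget)

noncomputable section

variable {d : ℕ} {n : Type*} [Fintype n] [DecidableEq n]

set_option maxHeartbeats 1600000 in
/-- **(P♮)_W ON THE FRAME-FREE BLOCK-LANDAU SLICE AT A CURVED BACKGROUND** (route H♮, the END of row K6; module docstring). [folklore] -/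
theorem slicePoincare_frameFreeBlockLandauW [Nonempty n] (hd : 3 ≤ d) {L N : ℕ} (hL : 2 ≤ L) (hN : 1 ≤ N) (k : ℕ)
    {W : Site d → Fin d → (Matrix n n ℂ)ˣ} {x : ℝ} (hWu : IsUnitaryCfg W) (hWP : IsPeriodicCfg W ((tower L N (k + 1) : ℕ) : ℤ))
    (hx : 0 ≤ x) (hs : LevelSmall d L k x) (hWx : SmallField W x) (hS2 : S2sum d L (k + 1) x ≤ rho d L / 2)
    (hsmall : 8 * d * (((L : ℝ) ^ (k + 1)) * (((d : ℝ) - 1) * (((L : ℝ) ^ (k + 1)) - 1) * x)) ^ 2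
      + 2 * (Fintype.card n * (4 * (d : ℝ) ^ 2 * ((L : ℝ) ^ (k + 1) - 1) ^ 2 * x + 16 * d * loopRad d L ((prop1Radius d L)^[k] x)) ^ 2)
        ≤ 1 / 2)
    {ε : ℝ} (hε : 0 < ε)
    (hSh : (((80 * d + 448) * (d : ℝ) ^ 2 * (((L : ℝ) ^ (k + 1)) ^ 2 * x) ^ 2) + 1 / 4 + 512 * (4 * (2 * ((4 * d + 5) / 10 * DSum d L (k + 1) x)) ^ 2 * ((L : ℝ) ^ (k + 1)) ^ 2) * (Fintype.card n : ℝ) / ((L : ℝ) ^ (k + 1)) ^ 2 + 16 * (((d : ℝ) - 1) * (((L : ℝ) ^ (k + 1)) - 1) * x) * (Real.sqrt ((Fintype.card n : ℝ) * d)) * ((L : ℝ) ^ (k + 1)) + 16 * (2 * (8 * loopRad d L ((prop1Radius d L)^[k] x)) + 2 * (2 * (((d : ℝ) - 1) * (((L : ℝ) ^ (k + 1)) - 1) * ((L : ℝ) ^ (k + 1)) * x))) * (Real.sqrt ((Fintype.card n : ℝ))) / ε ^ 2 + (18 + 1 / 4 + 16 * (2 * (8 * loopRad d L ((prop1Radius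 d L)^[k] x)) + 2 * (2 * (((d : ℝ) - 1) * (((L : ℝ) ^ (k + 1)) - 1) * ((L : ℝ) ^ (k + 1)) * x))) * (Real.sqrt ((Fintype.card n : ℝ))) / ε ^ 2) * ((2 * d * x + 32 * d * x ^ 2) * (Fintype.card n : ℝ) * ((L : ℝ) ^ (k + 1)) ^ 2)) ≤ 1 / 2)
    (hSy : 2 * (1 + (1 + 8 * ε) * (2 + (16 * (d : ℝ) * (1 / ((L : ℝ) ^ (k + 1)) + 2 * (((d : ℝ) - 1) * (((L : ℝ) ^ (k + 1)) - 1) * x)) ^ 2 * (64 : ℝ) ^ d * (4 * (d : ℝ) ^ 2 * (((L : ℝ) ^ (k + 1)) - 1) ^ 2 * x + 16 * d * loopRad d L ((prop1Radius d L)^[k] x)) ^ 2 * (Fintype.card n : ℝ)) * 8 * ((L : ℝ) ^ (k + 1)) ^ 2) * ((3 * ((2 : ℝ) ^ (d + 1)) * (((L : ℝ) ^ (k + 1)) ^ 2)⁻¹ + 3 * ((d : ℝ) * (1 / ((L : ℝ) ^ (k + 1)) + 2 * (((d : ℝ) - 1) * (((L : ℝ) ^ (k + 1)) - 1) * x)) ^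 2) * (2 * ((64 : ℝ) ^ d) * (((2 : ℝ) ^ (3 * d + 2)) * d))) * ((Fintype.card n : ℝ) * (2 * ((L : ℝ) ^ (k + 1)) ^ 2 + 2 * (4 * (2 * ((4 * d + 5) / 10 * DSum d L (k + 1) x)) ^ 2 * ((L : ℝ) ^ (k + 1)) ^ 2) * (Fintype.card n : ℝ))) + (12 * d * (48 * ((d : ℝ) * (L : ℝ))) + 3 * ((d : ℝ) * (1 / ((L : ℝ) ^ (k + 1)) + 2 * (((d : ℝ) - 1) * (((L : ℝ) ^ (k + 1)) - 1) * x)) ^ 2) * (2 * ((64 : ℝ) ^ d) * (48 * ((d : ℝ) * (L : ℝ))))) * (Fintype.card n : ℝ)))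
        * (512 * (16 * S2sum d L (k + 1) x ^ 2 * ((L : ℝ) ^ d * ((L : ℝ) ^ k) ^ 2)) * (Fintype.card n : ℝ) / ((L : ℝ) ^ (k + 1)) ^ 2 + 512 * (2 * ((d : ℝ) * (20 * loopRad d L ((prop1Radius d L)^[k] x)) ^ 2)) * (Fintype.card n : ℝ) / ε ^ 2 + 24 * ε + 8 * (8 * d * (((L : ℝ) ^ (k + 1)) * (((d : ℝ) - 1) * (((L : ℝ) ^ (k + 1)) - 1) * x)) ^ 2 + 2 * ((Fintype.card n : ℝ) * (4 * (d : ℝ) ^ 2 * (((L : ℝ) ^ (k + 1)) - 1) ^ 2 * x + 16 * d * loopRad d L ((prop1Radius d L)^[k] x)) ^ 2)) / ε + 16 * (((d : ℝ) - 1) * (((L : ℝ) ^ (k + 1)) - 1) * x) * (Real.sqrt ((Fintype.card n : ℝ) * d)) * ((L : ℝ) ^ (k + 1)) / ε ^ 2 + 8 * (2 * (8 * loopRad d L ((prop1Radius d L)^[k] x)) + 2 * (2 * (((d : ℝ) - 1) * (((L : ℝ) ^ (k + 1)) - 1) * ((L : ℝ) ^ (k + 1)) * x))) * (Real.sqrt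 ((Fintype.card n : ℝ))) * d + (18 + 1 / 4 + 16 * (2 * (8 * loopRad d L ((prop1Radius d L)^[k] x)) + 2 * (2 * (((d : ℝ) - 1) * (((L : ℝ) ^ (k + 1)) - 1) * ((L : ℝ) ^ (k + 1)) * x))) * (Real.sqrt ((Fintype.card n : ℝ))) / ε ^ 2) * ((16 * (d : ℝ) ^ 2 * x ^ 2) * ((L : ℝ) ^ (k + 1)) ^ 4 / ε ^ 2 + ε ^ 2))
        + ((1 + 8 * ε) * ((2 + (16 * (d : ℝ) * (1 / ((L : ℝ) ^ (k + 1)) + 2 * (((d : ℝ) - 1) * (((L : ℝ) ^ (k + 1)) - 1) * x)) ^ 2 * (64 : ℝ) ^ d * (4 * (d : ℝ) ^ 2 * (((L : ℝ) ^ (k + 1)) - 1) ^ 2 * x + 16 * d * loopRad d L ((prop1Radius d L)^[k] x)) ^ 2 * (Fintype.card n : ℝ)) * 8 * ((L : ℝ) ^ (k + 1)) ^ 2) * ((3 * ((2 : ℝ) ^ (d + 1)) * (((L : ℝ) ^ (k + 1)) ^ 2)⁻¹ + 3 * ((d : ℝ) * (1 / ((L : ℝ) ^ (k + 1)) + 2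 * (((d : ℝ) - 1) * (((L : ℝ) ^ (k + 1)) - 1) * x)) ^ 2) * (2 * ((64 : ℝ) ^ d) * (((2 : ℝ) ^ (3 * d + 2)) * d))) * ((Fintype.card n : ℝ) * (2 * (16 * S2sum d L (k + 1) x ^ 2 * ((L : ℝ) ^ d * ((L : ℝ) ^ k) ^ 2)) * (Fintype.card n : ℝ)) + (Fintype.card n : ℝ) * (2 * (2 * ((d : ℝ) * (20 * loopRad d L ((prop1Radius d L)^[k] x)) ^ 2)) * (Fintype.card n : ℝ)) * (((L : ℝ) ^ (k + 1)) ^ 2 / ε ^ 2)) + (3 * ((d : ℝ) * (2 : ℝ) ^ d * (8 * ((d : ℝ) * ((L : ℝ) ^ (k + 1)) * x) ^ 2 + (16 / ((L : ℝ) ^ (k + 1)) ^ 2) * (8 * loopRad d L ((prop1Radius d L)^[k] x) + 9 * (d : ℝ) ^ 2 * ((L : ℝ) ^ (k + 1)) ^ 2 * x) ^ 2)) + 3 * ((d : ℝ) * (1 / ((L : ℝ) ^ (k + 1)) + 2 * (((d : ℝ) - 1) * (((L : ℝ) ^ (k + 1)) - 1) * x)) ^ 2) * (2 * ((64 : ℝ)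 ^ d) * ((2 : ℝ) ^ d * ((2 : ℝ) ^ (2 * d + 4) * (d : ℝ) ^ 2 * ((d : ℝ) - 1) ^ 2 * (radIter d L (k + 1) x) ^ 2 + 8 * (9 * (d : ℝ) ^ 2 * ((L : ℝ) ^ (k + 1)) ^ 2 * x + (d : ℝ) * (8 * loopRad d L ((prop1Radius d L)^[k] x))) ^ 2)))) * (Fintype.card n : ℝ) * (((L : ℝ) ^ (k + 1)) ^ 2 / ε ^ 2)) + ((16 * (d : ℝ) * (1 / ((L : ℝ) ^ (k + 1)) + 2 * (((d : ℝ) - 1) * (((L : ℝ) ^ (k + 1)) - 1) * x)) ^ 2 * (64 : ℝ) ^ d * (4 * (d : ℝ) ^ 2 * (((L : ℝ) ^ (k + 1)) - 1) ^ 2 * x + 16 * d * loopRad d L ((prop1Radius d L)^[k] x)) ^ 2 * (Fintype.card n : ℝ)) * 8 * ((L : ℝ) ^ (k + 1)) ^ 2 + (16 * (d : ℝ) * (1 / ((L : ℝ) ^ (k + 1)) + 2 * (((d : ℝ) - 1) * (((L : ℝ) ^ (k + 1)) - 1) * x)) ^ 2 * (64 : ℝ) ^ d * (4 * (d : ℝ)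 ^ 2 * (((L : ℝ) ^ (k + 1)) - 1) ^ 2 * x + 16 * d * loopRad d L ((prop1Radius d L)^[k] x)) ^ 2 * (Fintype.card n : ℝ)) * (4 * (Fintype.card n : ℝ) * (4 * (d : ℝ) ^ 2 * (((L : ℝ) ^ (k + 1)) - 1) ^ 2 * x + 16 * d * loopRad d L ((prop1Radius d L)^[k] x)) ^ 2 + 1) * (((L : ℝ) ^ (k + 1)) ^ 2 / ε ^ 2))) + 9 * ε) ≤ 1 / 2) :
    SlicePoincare L (k + 1) W (frameFreeBlockLandauW (d := d) (n := n) L N (k + 1) W)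
      ((Fintype.card n : ℝ) * (16 * (18 + 1 / 4 + 16 * (2 * (8 * loopRad d L ((prop1Radius d L)^[k] x)) + 2 * (2 * (((d : ℝ) - 1) * (((L : ℝ) ^ (k + 1)) - 1) * ((L : ℝ) ^ (k + 1)) * x))) * (Real.sqrt ((Fintype.card n : ℝ))) / ε ^ 2) * (1 + (1 + 8 * ε) * (2 + (16 * (d : ℝ) * (1 / ((L : ℝ) ^ (k + 1)) + 2 * (((d : ℝ) - 1) * (((L : ℝ) ^ (k + 1)) - 1) * x)) ^ 2 * (64 : ℝ) ^ d * (4 * (d : ℝ) ^ 2 * (((L : ℝ) ^ (k + 1)) - 1) ^ 2 * x + 16 * d * loopRad d L ((prop1Radius d L)^[k] x)) ^ 2 * (Fintype.card n : ℝ)) * 8 * ((L : ℝ) ^ (k + 1)) ^ 2) * ((3 * ((2 : ℝ) ^ (d + 1)) * (((L : ℝ) ^ (k + 1)) ^ 2)⁻¹ + 3 * ((d : ℝ) * (1 / ((L : ℝ) ^ (k + 1)) + 2 * (((d : ℝ) - 1) * (((L : ℝ) ^ (k + 1)) - 1) * x)) ^ 2) * (2 * ((64 : ℝ) ^ d) *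 (((2 : ℝ) ^ (3 * d + 2)) * d))) * ((Fintype.card n : ℝ) * (2 * ((L : ℝ) ^ (k + 1)) ^ 2 + 2 * (4 * (2 * ((4 * d + 5) / 10 * DSum d L (k + 1) x)) ^ 2 * ((L : ℝ) ^ (k + 1)) ^ 2) * (Fintype.card n : ℝ))) + (12 * d * (48 * ((d : ℝ) * (L : ℝ))) + 3 * ((d : ℝ) * (1 / ((L : ℝ) ^ (k + 1)) + 2 * (((d : ℝ) - 1) * (((L : ℝ) ^ (k + 1)) - 1) * x)) ^ 2) * (2 * ((64 : ℝ) ^ d) * (48 * ((d : ℝ) * (L : ℝ))))) * (Fintype.card n : ℝ))))) (periodBox (d := d) (N * L ^ (k + 1))) := by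
  haveI : NeZero N := ⟨by omega⟩
  have hd1 : 1 ≤ d := by omega
  have hL1 : 1 ≤ L := le_trans (by norm_num) hL
  have hM2 : 2 ≤ L ^ (k + 1) := le_trans hL (Nat.le_self_pow (Nat.succ_ne_zero k) L)
  have htow : tower L N (k + 1) = L ^ (k + 1) * N := NE3CurvedProjectedLandau.tower_eq_pow_mul L N (k + 1)
  have hP : 1 ≤ tower L N (k + 1) := by rw [htow]; exact Nat.one_le_iff_ne_zero.2 (Nat.mul_ne_zero (by omega) (by omega))
  have hP' : 1 ≤ L ^ (k + 1) * N := by rw [← htow]; exact hP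
  have hMR : (((L ^ (k + 1) : ℕ) : ℝ)) = (L : ℝ) ^ (k + 1) := by push_cast; ring
  have hM2R : (2 : ℝ) ≤ (L : ℝ) ^ (k + 1) := by
    have h2 : ((2 : ℕ) : ℝ) ≤ ((L ^ (k + 1) : ℕ) : ℝ) := by exact_mod_cast hM2
    rw [hMR] at h2
    exact_mod_cast h2
  have hM0 : (0 : ℝ) < (L : ℝ) ^ (k + 1) := by linarith only [hM2R]
  have hc1 : (1 : ℝ) ≤ (Fintype.card n : ℝ) := by exact_mod_cast Fintype.card_pos
  have hrk := NE3CovariantLineSumsError.iterate_prop1Radius_nonneg (d := d) (L := L) k hx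
  have hlr : 0 ≤ loopRad d L ((prop1Radius d L)^[k] x) := by
    unfold SpreadLift.loopRad
    exact mul_nonneg (by norm_num) (mul_nonneg (by positivity) hrk)
  have hΛ : 0 ≤ (L : ℝ) ^ d * ((L : ℝ) ^ k) ^ 2 := by positivity
  have hWP' : IsPeriodicCfg W ((L ^ (k + 1) * N : ℕ) : ℤ) := by rw [← htow]; exact hWP
  have hE := E_le_half_of_levelSmall (d := d) hL1 k hx hs
  -- the constant is nonnegative
  have hdm : (0 : ℝ) ≤ (d : ℝ) - 1 := by
    have : (1 : ℝ) ≤ d := by exact_mod_cast hd1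
    linarith only [this]
  have hMm : (0 : ℝ) ≤ (L : ℝ) ^ (k + 1) - 1 := by linarith only [hM2R]
  have hcxM : 0 ≤ ((d : ℝ) - 1) * ((L : ℝ) ^ (k + 1) - 1) * ((L : ℝ) ^ (k + 1)) * x := mul_nonneg (mul_nonneg (mul_nonneg hdm hMm) hM0.le) hx
  have hcf : 0 ≤ 2 * (8 * loopRad d L ((prop1Radius d L)^[k] x)) + 2 * (2 * (((d : ℝ) - 1) * (((L : ℝ) ^ (k + 1)) - 1) * ((L : ℝ) ^ (k + 1)) * x)) := by
    linarith only [hcxM, hlr]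
  have hA0 : 0 ≤ (18 + 1 / 4 + 16 * (2 * (8 * loopRad d L ((prop1Radius d L)^[k] x)) + 2 * (2 * (((d : ℝ) - 1) * (((L : ℝ) ^ (k + 1)) - 1) * ((L : ℝ) ^ (k + 1)) * x))) * (Real.sqrt ((Fintype.card n : ℝ))) / ε ^ 2) := by positivity
  have hbh : 0 ≤ ((3 * ((2 : ℝ) ^ (d + 1)) * (((L : ℝ) ^ (k + 1)) ^ 2)⁻¹ + 3 * ((d : ℝ) * (1 / ((L : ℝ) ^ (k + 1)) + 2 * (((d : ℝ) - 1) * (((L : ℝ) ^ (k + 1)) - 1) * x)) ^ 2) * (2 * ((64 : ℝ) ^ d) * (((2 : ℝ) ^ (3 * d + 2)) * d))) * ((Fintype.card n : ℝ) * (2 * ((L : ℝ) ^ (k + 1)) ^ 2 + 2 * (4 * (2 * ((4 * d + 5) / 10 * DSum d L (k + 1) x)) ^ 2 * ((L : ℝ) ^ (k + 1)) ^ 2) * (Fintype.card n : ℝ))) + (12 * d * (48 * ((d : ℝ) * (L : ℝ))) + 3 * ((d : ℝ) * (1 / ((L : ℝ) ^ (k + 1)) + 2 * (((d : ℝ) -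 1) * (((L : ℝ) ^ (k + 1)) - 1) * x)) ^ 2) * (2 * ((64 : ℝ) ^ d) * (48 * ((d : ℝ) * (L : ℝ))))) * (Fintype.card n : ℝ)) := by positivity
  have hKh : 0 ≤ (1 + (1 + 8 * ε) * (2 + (16 * (d : ℝ) * (1 / ((L : ℝ) ^ (k + 1)) + 2 * (((d : ℝ) - 1) * (((L : ℝ) ^ (k + 1)) - 1) * x)) ^ 2 * (64 : ℝ) ^ d * (4 * (d : ℝ) ^ 2 * (((L : ℝ) ^ (k + 1)) - 1) ^ 2 * x + 16 * d * loopRad d L ((prop1Radius d L)^[k] x)) ^ 2 * (Fintype.card n : ℝ)) * 8 * ((L : ℝ) ^ (k + 1)) ^ 2) * ((3 * ((2 : ℝ) ^ (d + 1)) * (((L : ℝ) ^ (k + 1)) ^ 2)⁻¹ + 3 * ((d : ℝ) * (1 / ((L : ℝ) ^ (k + 1)) + 2 * (((d : ℝ) - 1) * (((L : ℝ) ^ (k + 1)) - 1) * x)) ^ 2) * (2 * ((64 : ℝ) ^ d) * (((2 : ℝ) ^ (3 * d + 2)) * d))) * ((Fintype.card n : ℝ) * (2 * ((L : ℝ) ^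 (k + 1)) ^ 2 + 2 * (4 * (2 * ((4 * d + 5) / 10 * DSum d L (k + 1) x)) ^ 2 * ((L : ℝ) ^ (k + 1)) ^ 2) * (Fintype.card n : ℝ))) + (12 * d * (48 * ((d : ℝ) * (L : ℝ))) + 3 * ((d : ℝ) * (1 / ((L : ℝ) ^ (k + 1)) + 2 * (((d : ℝ) - 1) * (((L : ℝ) ^ (k + 1)) - 1) * x)) ^ 2) * (2 * ((64 : ℝ) ^ d) * (48 * ((d : ℝ) * (L : ℝ))))) * (Fintype.card n : ℝ))) := by
    have h1 : 0 ≤ (1 + 8 * ε) * (2 + (16 * (d : ℝ) * (1 / ((L : ℝ) ^ (k + 1)) + 2 * (((d : ℝ) - 1) * (((L : ℝ) ^ (k + 1)) - 1) * x)) ^ 2 * (64 : ℝ) ^ d * (4 * (d : ℝ) ^ 2 * (((L : ℝ) ^ (k + 1)) - 1) ^ 2 * x + 16 * d * loopRad d L ((prop1Radius d L)^[k] x)) ^ 2 * (Fintype.card n : ℝ)) * 8 * ((L : ℝ) ^ (k + 1)) ^ 2) * ((3 * ((2 : ℝ) ^ (d + 1)) * (((L : ℝ) ^ (k + 1)) ^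 2)⁻¹ + 3 * ((d : ℝ) * (1 / ((L : ℝ) ^ (k + 1)) + 2 * (((d : ℝ) - 1) * (((L : ℝ) ^ (k + 1)) - 1) * x)) ^ 2) * (2 * ((64 : ℝ) ^ d) * (((2 : ℝ) ^ (3 * d + 2)) * d))) * ((Fintype.card n : ℝ) * (2 * ((L : ℝ) ^ (k + 1)) ^ 2 + 2 * (4 * (2 * ((4 * d + 5) / 10 * DSum d L (k + 1) x)) ^ 2 * ((L : ℝ) ^ (k + 1)) ^ 2) * (Fintype.card n : ℝ))) + (12 * d * (48 * ((d : ℝ) * (L : ℝ))) + 3 * ((d : ℝ) * (1 / ((L : ℝ) ^ (k + 1)) + 2 * (((d : ℝ) - 1) * (((L : ℝ) ^ (k + 1)) - 1) * x)) ^ 2) * (2 * ((64 : ℝ) ^ d) * (48 * ((d : ℝ) * (L : ℝ))))) * (Fintype.card n : ℝ)) :=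
      mul_nonneg (mul_nonneg (by linarith only [hε]) (by positivity)) hbh
    linarith only [h1]
  have hC : 0 ≤ 16 * (18 + 1 / 4 + 16 * (2 * (8 * loopRad d L ((prop1Radius d L)^[k] x)) + 2 * (2 * (((d : ℝ) - 1) * (((L : ℝ) ^ (k + 1)) - 1) * ((L : ℝ) ^ (k + 1)) * x))) * (Real.sqrt ((Fintype.card n : ℝ))) / ε ^ 2) * (1 + (1 + 8 * ε) * (2 + (16 * (d : ℝ) * (1 / ((L : ℝ) ^ (k + 1)) + 2 * (((d : ℝ) - 1) * (((L : ℝ) ^ (k + 1)) - 1) * x)) ^ 2 * (64 : ℝ) ^ d * (4 * (d : ℝ) ^ 2 * (((L : ℝ) ^ (k + 1)) - 1) ^ 2 * x + 16 * d * loopRad d L ((prop1Radius d L)^[k] x)) ^ 2 * (Fintype.card n : ℝ)) * 8 * ((L : ℝ) ^ (k + 1)) ^ 2) * ((3 * ((2 : ℝ) ^ (d + 1)) * (((L : ℝ) ^ (k + 1)) ^ 2)⁻¹ + 3 * ((d : ℝ) * (1 / ((L : ℝ) ^ (k + 1)) + 2 * (((d : ℝ) - 1) * (((L : ℝ) ^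 (k + 1)) - 1) * x)) ^ 2) * (2 * ((64 : ℝ) ^ d) * (((2 : ℝ) ^ (3 * d + 2)) * d))) * ((Fintype.card n : ℝ) * (2 * ((L : ℝ) ^ (k + 1)) ^ 2 + 2 * (4 * (2 * ((4 * d + 5) / 10 * DSum d L (k + 1) x)) ^ 2 * ((L : ℝ) ^ (k + 1)) ^ 2) * (Fintype.card n : ℝ))) + (12 * d * (48 * ((d : ℝ) * (L : ℝ))) + 3 * ((d : ℝ) * (1 / ((L : ℝ) ^ (k + 1)) + 2 * (((d : ℝ) - 1) * (((L : ℝ) ^ (k + 1)) - 1) * x)) ^ 2) * (2 * ((64 : ℝ) ^ d) * (48 * ((d : ℝ) * (L : ℝ))))) * (Fintype.card n : ℝ))) := by positivity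
  refine slicePoincare_of_nhs hC fun Y hY => ?_
  rw [Nat.mul_comm N (L ^ (k + 1))]
  -- the K1 package at the cut `ϑ := ε²/M²`
  have hYs : IsSkewDir Y := hY.1
  have hYP : IsPeriodicDir Y ((tower L N (k + 1) : ℕ) : ℤ) := hY.2.1
  have hYP' : IsPeriodicDir Y ((L ^ (k + 1) * N : ℕ) : ℤ) := by rw [← htow]; exact hYP
  have hϑ : (0 : ℝ) < ε ^ 2 / ((L : ℝ) ^ (k + 1)) ^ 2 := by positivity
  haveI : NeZero (L ^ (k + 1) * N) := NeZero.of_pos (show 0 < L ^ (k + 1) * N by omega)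
  obtain ⟨η', ζ', cc, hη'P, hζ'P, -, -, hζ's, -, hYeq, -, hZ, hr, horth, hpy⟩ :=
    exists_covHodge_cut (P := L ^ (k + 1) * N) hWu hP' hWP' hϑ hYP' hYs
  have hη'Pt : IsPeriodicDir η' ((tower L N (k + 1) : ℕ) : ℤ) := by rw [htow]; exact hη'P
  have hζ'Pt : ∀ (y : Site d) (τ : Fin d), ζ' (y + ((tower L N (k + 1) : ℕ) : ℤ) • e τ) = ζ' y := by rw [htow]; exact hζ'P
  have hortht : ∑ y ∈ periodBox (d := d) (tower L N (k + 1)), hsR (ζ' y) (covDiv W η' y) = 0 := by rw [htow]; exact horth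
  -- the named inequalities
  have heta := eta_sq_le hd1 hL hN k hWu hWP hx hs hWx hS2 hY hη'Pt hζ'Pt hζ's hYeq hortht
  rw [hMR] at heta
  have hS5 := covFd_energy_le (P := L ^ (k + 1) * N) hP' hWu hWP' hx hWx hYP' hζ'P (η' := η')
    (fun y κ => eq_sub_of_add_eq (hYeq y κ).symm)
  obtain ⟨ζt, hξ, hζtP, -, hGt⟩ := exists_competitor hd hL hN k hWu hWP hx hs hWx hS2 hE hsmall hY hη'Pt hζ'Pt hζ's hYeq
  have hyb := y_sq_le k hP hWu hY hη'Pt hζtP hYeq hξ hortht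
  have hXi := xi_sq_le hL N k hWu hx hs hWx hsmall hξ
  have hJ := sum_nhsNormSq_bmeanIterW_le_one hL1 k hWu hx hs hWx ζ' N
  have hA : ∑ z ∈ periodBox (d := d) N, ((L : ℝ) ^ (k + 1)) ^ d * nhsNormSq (bmeanIterW L (k + 1) W ζ' z)
      = ((L : ℝ) ^ (k + 1)) ^ d * ∑ z ∈ periodBox (d := d) N, nhsNormSq (bmeanIterW L (k + 1) W ζ' z) := by
    rw [Finset.mul_sum]
  have hDG : ∑ y ∈ periodBox (d := d) (L ^ (k + 1) * N), ∑ κ : Fin d, nhsNormSq (AveragingDeficitCovGrad.covFd W η' y κ κ)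
      ≤ ∑ y ∈ periodBox (d := d) (L ^ (k + 1) * N), ∑ μ : Fin d, ∑ ν : Fin d, nhsNormSq (AveragingDeficitCovGrad.covFd W η' y μ ν) :=
    sum_le_sum fun y _ => sum_le_sum fun μ _ =>
      Finset.single_le_sum (f := fun ν => nhsNormSq (AveragingDeficitCovGrad.covFd W η' y μ ν)) (fun ν _ => nhsNormSq_nonneg _) (Finset.mem_univ μ)
  -- signs of the letters
  have hy0 : 0 ≤ ∑ y ∈ periodBox (d := d) (L ^ (k + 1) * N), ∑ κ : Fin d, nhsNormSq (Y y κ) := sum_nonneg fun _ _ => sum_nonneg fun _ _ => nhsNormSq_nonneg _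
  have hh0 : 0 ≤ ∑ y ∈ periodBox (d := d) (L ^ (k + 1) * N), ∑ κ : Fin d, nhsNormSq (η' y κ) := sum_nonneg fun _ _ => sum_nonneg fun _ _ => nhsNormSq_nonneg _
  have hG0 : 0 ≤ ∑ y ∈ periodBox (d := d) (L ^ (k + 1) * N), ∑ κ : Fin d, nhsNormSq (gaugeDir W ζ' y κ) := sum_nonneg fun _ _ => sum_nonneg fun _ _ => nhsNormSq_nonneg _
  have hZ0 : 0 ≤ ∑ y ∈ periodBox (d := d) (L ^ (k + 1) * N), nhsNormSq (ζ' y) := sum_nonneg fun _ _ => nhsNormSq_nonneg _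
  have hr0 : 0 ≤ ∑ y ∈ periodBox (d := d) (L ^ (k + 1) * N), nhsNormSq (covDiv W η' y) := sum_nonneg fun _ _ => nhsNormSq_nonneg _
  have hDG0 : 0 ≤ ∑ y ∈ periodBox (d := d) (L ^ (k + 1) * N), ∑ κ : Fin d, nhsNormSq (AveragingDeficitCovGrad.covFd W η' y κ κ) :=
    sum_nonneg fun _ _ => sum_nonneg fun _ _ => nhsNormSq_nonneg _
  have hA10 : 0 ≤ ∑ z ∈ periodBox (d := d) N, ((L : ℝ) ^ (k + 1)) ^ d * nhsNormSq (bmeanIterW L (k + 1) W ζ' z) :=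
    sum_nonneg fun _ _ => mul_nonneg (by positivity) (nhsNormSq_nonneg _)
  have hA20 : 0 ≤ ∑ z ∈ periodBox (d := d) N, nhsNormSq (bmeanIterW L (k + 1) W ζ' z) := sum_nonneg fun _ _ => nhsNormSq_nonneg _
  have hXi0 : 0 ≤ ∑ y ∈ periodBox (d := d) (L ^ (k + 1) * N), nhsNormSq (ζt y - ζ' y) := sum_nonneg fun _ _ => nhsNormSq_nonneg _
  have hfin := budget (d := d) (L := L) (c := Fintype.card n) hd1 hM2R hε hc1 hx hlr hΛ hy0 hh0 hG0 hZ0 hr0 hDG0 hA10 hA20 hXi0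
    hpy hZ hr hS5 hDG hJ hA heta hyb hXi hGt hSh hSy
  rw [← mul_assoc] at hfin
  exact hfin

end

end Summit.QuantumFields.BalabanUV.T4Continuum.NE3SlicePoincareCurved
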